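import Summits.AtomisticToContinuum.Crystallization.Theses.PricedLinkCensus
import Summits.AtomisticToContinuum.Crystallization.Theorems.TruncatedCensusGap.Negative.KappaZeroHalf
import Summits.AtomisticToContinuum.Crystallization.Theorems.PricedLinkCensusTruncatedCensusGapPeriodicStability
import Summits.AtomisticToContinuum.Crystallization.Theorems.PricedLinkCensusTruncatedCensusGapSuperstableRedistribution
import Literature.MathematicalPhysics.StatisticalMechanics.LennardJonesClusters

/-!
# Compact-strata reduction of `TruncatedCensusGap` modulo charge locality

Stub `truncatedCensusGap_of_separatedDense_of_locality` of the line `sharp-m-potential-compactness`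
for the crux `PricedLinkCensus.TruncatedCensusGap` (item stmt-AtomisticToContinuum-14230).  The
final statement is the registered signature VERBATIM.

With `V = V_χ = min 1 (max 0 (4 - 2r)) · V_LJ` (range `2`) and `e* = ⨅_Q e_V(Q)`: the priced gap
`N e* + κ #charged ≤ E_V(y)` for UNIFORMLY `1/4`-SEPARATED, `2`-DENSE injective configurations,
together with CHARGE LOCALITY (charge-freeness of a site of a sub-configuration containing every
site within `2(1+η) nn` of it agrees with charge-freeness in the full configuration), gives the
priced gap for ALL finite injective configurations, with `κ' = min κ (1 / (24 (K + 1)))`,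
`K = (2 · (101/25) / (1/4) + 1)³` a packing constant.

Proof.  (a) The `1/4`-crowd-free sites are the range of an embedding `f`; (b) by the landed
Ruelle superstability in transfer form (`stub_superstableRedistribution`) `E(y) ≥ E(y ∘ f)`;
(c) dropping the sites of `y ∘ f` farther than `2` from every other site (range of `g`) does not
change the energy and leaves a `1/4`-separated `2`-dense configuration `z`; (d) the hypothesis
prices `z`; (e) `e* ≤ -1/24` (pair cluster, `iInf_energyPerParticle_le_div` and the landed
periodic stability), so the `N - L` dropped sites contribute `≤ -(N - L)/24` to `N e*`; (f) a site
of `z` charged in `y` but charge-free in `z` has, by locality, a dropped site within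
`2 (1 + 1/100) · 2 = 101/25`, and by packing at most `K` crowd-free sites lie within `101/25`
of any site, so `#charged(y) ≤ (K + 1)(N - L) + #charged(z)`; (g) assemble.
-/

namespace Summit.AtomisticToContinuum.Crystallization.Theorems.PricedLinkCensusTruncatedCensusGap

open scoped BigOperators Classical
open Literature.MathematicalPhysics.StatisticalMechanics Literature.Geometry.DiscreteGeometry

/-! ## Enumerations, packing, double counting -/

/-- The sites satisfying a predicate are the range of an embedding `Fin M ↪ Fin N`. [folklore] -/
private theorem exists_enum {N : ℕ} (p : Fin N → Prop) :
    ∃ (M : ℕ) (f : Fin M ↪ Fin N), ∀ k : Fin N, k ∈ Set.range f ↔ p k := by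
  -- adapted from `exists_crowdFree_enum` (…SeparatedReductionAux.lean)
  set s := Finset.univ.filter fun k : Fin N => p k with hs
  refine ⟨s.card, (s.orderEmbOfFin rfl).toEmbedding, fun k => ?_⟩
  rw [show Set.range ⇑(s.orderEmbOfFin rfl).toEmbedding = Set.range (s.orderEmbOfFin rfl)
      from rfl, Finset.range_orderEmbOfFin, Finset.mem_coe, hs, Finset.mem_filter]
  simp

/-- Membership in `univ.map f` is membership in the range of `f`. [folklore] -/
private theorem mem_map_univ_iff {M N : ℕ} (f : Fin M ↪ Fin N) (k : Fin N) :
    k ∈ Finset.univ.map f ↔ k ∈ Set.range f := by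
  simp

/-- PACKING: at most `(2R/r₀ + 1)³` sites that are `r₀`-separated from every other site lie
within `R` of any site (`card_le_of_separated_of_dist_le`). [folklore] -/
private theorem card_near_le {N : ℕ} {y : Fin N → EuclideanSpace ℝ (Fin 3)}
    (hy : Function.Injective y) {r₀ R : ℝ} (hr₀ : 0 < r₀) (hR : 0 ≤ R) (j : Fin N) :
    ((Finset.univ.filter fun i : Fin N =>
        (∀ k : Fin N, k ≠ i → r₀ ≤ dist (y k) (y i)) ∧ dist (y i) (y j) ≤ R).card : ℝ) ≤
      (2 * R / r₀ + 1) ^ Module.finrank ℝ (EuclideanSpace ℝ (Fin 3)) := by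
  -- adapted from `card_crowdFree_near_le` (Lines/sharp_m_potential_compactness.lean)
  set S := Finset.univ.filter fun i : Fin N =>
    (∀ k : Fin N, k ≠ i → r₀ ≤ dist (y k) (y i)) ∧ dist (y i) (y j) ≤ R
  have hcard : (S.image y).card = S.card := Finset.card_image_of_injective _ hy
  have h := card_le_of_separated_of_dist_le (S.image y) (y j) hr₀ hR ?_ ?_
  · rwa [hcard] at h
  · intro c hc
    obtain ⟨i, hi, rfl⟩ := Finset.mem_image.1 hc
    exact (Finset.mem_filter.1 hi).2.2
  · intro c hc d hd hcd
    obtain ⟨i, hi, rfl⟩ := Finset.mem_image.1 hc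
    obtain ⟨i', hi', rfl⟩ := Finset.mem_image.1 hd
    exact (Finset.mem_filter.1 hi').2.1 i fun h => hcd (h ▸ rfl)

/-- DOUBLE COUNTING: a set `P` of sites `r₀`-separated from everything, each with a site of `Q`
within `R`, has at most `(2R/r₀ + 1)³ · #Q` elements. [folklore] -/
private theorem card_le_mul_card {N : ℕ} {y : Fin N → EuclideanSpace ℝ (Fin 3)}
    (hy : Function.Injective y) {r₀ R : ℝ} (hr₀ : 0 < r₀) (hR : 0 ≤ R) (P Q : Finset (Fin N))
    (hP : ∀ i ∈ P, (∀ k : Fin N, k ≠ i → r₀ ≤ dist (y k) (y i)) ∧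
      ∃ j ∈ Q, dist (y i) (y j) ≤ R) :
    (P.card : ℝ) ≤ (2 * R / r₀ + 1) ^ Module.finrank ℝ (EuclideanSpace ℝ (Fin 3)) * Q.card := by
  -- adapted from `card_le_mul_card_crowded` (Lines/sharp_m_potential_compactness.lean)
  set K : ℝ := (2 * R / r₀ + 1) ^ Module.finrank ℝ (EuclideanSpace ℝ (Fin 3)) with hK
  have hK0 : 0 ≤ K := by positivity
  let w : Fin N → Fin N := fun i =>
    if h : ∃ j ∈ Q, dist (y i) (y j) ≤ R then Classical.choose h else i
  have hw : ∀ i ∈ P, w i ∈ Q ∧ dist (y i) (y (w i)) ≤ R := by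
    intro i hi
    obtain ⟨-, hex⟩ := hP i hi
    simp only [w, dif_pos hex]
    exact Classical.choose_spec hex
  have himg : P.image w ⊆ Q := by
    intro j hj
    obtain ⟨i, hi, rfl⟩ := Finset.mem_image.1 hj
    exact (hw i hi).1
  have hfib : ∀ j ∈ P.image w, ((P.filter fun i => w i = j).card : ℝ) ≤ K := by
    intro j _
    have hsub : (P.filter fun i => w i = j) ⊆ Finset.univ.filter fun i : Fin N =>
        (∀ k : Fin N, k ≠ i → r₀ ≤ dist (y k) (y i)) ∧ dist (y i) (y j) ≤ R := by
      intro i hi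
      obtain ⟨hiP, hwi⟩ := Finset.mem_filter.1 hi
      refine Finset.mem_filter.2 ⟨Finset.mem_univ _, (hP i hiP).1, ?_⟩
      have := (hw i hiP).2
      rwa [hwi] at this
    calc ((P.filter fun i => w i = j).card : ℝ)
        ≤ ((Finset.univ.filter fun i : Fin N => (∀ k : Fin N, k ≠ i → r₀ ≤ dist (y k) (y i)) ∧
            dist (y i) (y j) ≤ R).card : ℝ) := by
          exact_mod_cast Finset.card_le_card hsub
      _ ≤ K := card_near_le hy hr₀ hR j
  calc (P.card : ℝ) = ∑ j ∈ P.image w, ((P.filter fun i => w i = j).card : ℝ) := by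
        rw [Finset.card_eq_sum_card_image w P]
        push_cast
        rfl
    _ ≤ ∑ j ∈ P.image w, K := Finset.sum_le_sum hfib
    _ = K * (P.image w).card := by rw [Finset.sum_const, nsmul_eq_mul, mul_comm]
    _ ≤ K * Q.card := by
        have himg' : ((P.image w).card : ℝ) ≤ Q.card := by
          exact_mod_cast Finset.card_le_card himg
        exact mul_le_mul_of_nonneg_left himg' hK0

/-! ## Energies of sub-configurations -/

/-- Dropping sites farther than the range `2` of `V` from every other site does not change the
energy. [folklore] -/
private theorem interactionEnergy_sub_eq (V : ℝ → ℝ) (hV : ∀ r, 2 ≤ r → V r = 0)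
    {M L : ℕ} (x : Fin M → EuclideanSpace ℝ (Fin 3)) (g : Fin L ↪ Fin M)
    (hg : ∀ a : Fin M, a ∉ Set.range g → ∀ b : Fin M, b ≠ a → 2 < dist (x a) (x b)) :
    interactionEnergy V (x ∘ g) = interactionEnergy V x := by
  have h2 := two_mul_interactionEnergy V x
  have h2' := two_mul_interactionEnergy V (x ∘ g)
  suffices h : ∑ a, siteEnergy V x a = ∑ c, siteEnergy V (x ∘ g) c by linarith
  have hz : ∀ a b : Fin M, b ∉ Set.range g → a ≠ b → V (dist (x a) (x b)) = 0 :=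
    fun a b hb hab => hV _ (by rw [dist_comm]; exact (hg b hb a hab).le)
  have hnot : ∀ b : Fin M, b ∉ Finset.univ.map g → b ∉ Set.range g :=
    fun b hb hb' => hb ((mem_map_univ_iff g b).2 hb')
  calc ∑ a, siteEnergy V x a = ∑ a ∈ Finset.univ.map g, siteEnergy V x a := by
        refine (Finset.sum_subset (Finset.subset_univ _) fun a _ ha => ?_).symm
        exact Finset.sum_eq_zero fun b hb =>
          hV _ (hg a (hnot a ha) b (Finset.ne_of_mem_erase hb)).le
    _ = ∑ c, siteEnergy V x (g c) := Finset.sum_map _ _ _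
    _ = ∑ c, siteEnergy V (x ∘ g) c := Finset.sum_congr rfl fun c _ => ?_
  unfold siteEnergy
  symm
  calc ∑ k ∈ Finset.univ.erase c, V (dist ((x ∘ g) c) ((x ∘ g) k))
      = ∑ b ∈ (Finset.univ.erase c).map g, V (dist (x (g c)) (x b)) := by
        rw [Finset.sum_map]
        rfl
    _ = ∑ b ∈ Finset.univ.erase (g c), V (dist (x (g c)) (x b)) := by
        refine Finset.sum_subset (fun b hb => ?_) fun b hb hb' => ?_
        · obtain ⟨k, hk, rfl⟩ := Finset.mem_map.1 hb
          exact Finset.mem_erase.2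
            ⟨fun h => Finset.ne_of_mem_erase hk (g.injective h), Finset.mem_univ _⟩
        · refine hz _ _ (fun ⟨k, hk⟩ => hb' (Finset.mem_map.2 ⟨k, ?_, hk⟩))
            (Finset.ne_of_mem_erase hb).symm
          exact Finset.mem_erase.2
            ⟨fun h => Finset.ne_of_mem_erase hb (by rw [← hk, h]), Finset.mem_univ _⟩

/-- **Superstability step.** The energy of an injective configuration is at least the energy of
its `1/4`-crowd-free sub-configuration (landed `stub_superstableRedistribution`: the half site
energies plus a null-Lagrangian transfer are `≥ 1 ≥ 0` at crowded sites and dominate the half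
site energies of the sub-configuration at crowd-free sites). [folklore] -/
private theorem interactionEnergy_crowdFree_le {N M : ℕ}
    (y : Fin N → EuclideanSpace ℝ (Fin 3)) (hy : Function.Injective y) (f : Fin M ↪ Fin N)
    (hf : ∀ k : Fin N, k ∈ Set.range f ↔ ∀ k' : Fin N, k' ≠ k → 1 / 4 ≤ dist (y k') (y k)) :
    interactionEnergy (fun r => min 1 (max 0 (4 - 2 * r)) * lennardJones r) (y ∘ f) ≤
      interactionEnergy (fun r => min 1 (max 0 (4 - 2 * r)) * lennardJones r) y := by
  obtain ⟨ρ, F, -, hsum0, -, hcf, hcrowd⟩ := stub_superstableRedistribution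
  set V : ℝ → ℝ := fun r => min 1 (max 0 (4 - 2 * r)) * lennardJones r with hV
  have h2 := two_mul_interactionEnergy V y
  have h2' := two_mul_interactionEnergy V (y ∘ f)
  have hE : interactionEnergy V y = ∑ i, (siteEnergy V y i / 2 + F N y i) := by
    rw [Finset.sum_add_distrib, hsum0 N y hy, add_zero, ← Finset.sum_div]
    linarith
  have h1 : ∑ a, siteEnergy V (y ∘ f) a / 2 ≤
      ∑ i ∈ Finset.univ.map f, (siteEnergy V y i / 2 + F N y i) := by
    rw [Finset.sum_map]
    exact Finset.sum_le_sum fun a _ => hcf N M y f a hy hf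
  have h3 : 0 ≤ ∑ i ∈ (Finset.univ.map f)ᶜ, (siteEnergy V y i / 2 + F N y i) :=
    Finset.sum_nonneg fun i hi => by
      have hi' : i ∉ Set.range f := fun h =>
        (Finset.mem_compl.1 hi) ((mem_map_univ_iff f i).2 h)
      linarith [hcrowd N y i hy fun h => hi' ((hf i).2 h)]
  rw [hE, ← Finset.sum_add_sum_compl (Finset.univ.map f)]
  have : interactionEnergy V (y ∘ f) = ∑ a, siteEnergy V (y ∘ f) a / 2 := by
    rw [← Finset.sum_div]
    linarith
  linarith

/-! ## The reduction -/

/-- **Compact-strata reduction of `TruncatedCensusGap` modulo charge locality** (registered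
signature of the line `sharp-m-potential-compactness`): the priced gap on uniformly
`1/4`-separated, `2`-dense finite injective configurations together with charge locality implies
the priced gap on all finite injective configurations, i.e. `TruncatedCensusGap`. [folklore] -/
theorem truncatedCensusGap_of_separatedDense_of_locality : (∀ (η : ℝ), 0 ≤ η → ∀ (N M : ℕ) (y : Fin N → EuclideanSpace ℝ (Fin 3)) (f : Fin M ↪ Fin N) (i : Fin M), (∀ k : Fin N, dist (y k) (y (f i)) ≤ 2 * (1 + η) * nearestDist y (f i) → k ∈ Set.range f) → (IsChargeFree η y (f i) ↔ IsChargeFree η (y ∘ f) i)) → (∃ κ : ℝ, 0 < κ ∧ ∀ (N : ℕ) (y : Fin N → EuclideanSpace ℝ (Fin 3)), Function.Injective y → (∀ j k : Fin N, j ≠ k → 1 / 4 ≤ dist (y j) (y k)) → (∀ j : Fin N, ∃ k : Fin N, k ≠ j ∧ dist (y j) (y k) ≤ 2) → (N : ℝ) * (⨅ Q : PeriodicConfiguration 3, Q.energyPerParticle (fun r => min 1 (max 0 (4 - 2 * r)) * lennardJones r)) + κ * (Nat.card {i : Fin N // ¬ IsChargeFree (1 / 100 : ℝ) y i} : ℝ)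 ≤ interactionEnergy (fun r => min 1 (max 0 (4 - 2 * r)) * lennardJones r) y) → Summit.AtomisticToContinuum.Crystallization.Theses.PricedLinkCensus.TruncatedCensusGap := by
  intro hloc hsep
  obtain ⟨κ, hκ, hgap⟩ := hsep
  unfold Summit.AtomisticToContinuum.Crystallization.Theses.PricedLinkCensus.TruncatedCensusGap
  -- (e) `e* ≤ -1/24` from the pair cluster and periodic stability
  have heStar : (⨅ Q : PeriodicConfiguration 3,
      Q.energyPerParticle (fun r => min 1 (max 0 (4 - 2 * r)) * lennardJones r)) ≤ -1 / 24 := by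
    have h := iInf_energyPerParticle_le_div (R := 2) truncLJ_eq_zero_of_two_le
      stub_periodicStability injective_pair_zero_single (by norm_num : (0 : ℕ) < 2)
    rw [interactionEnergy_truncLJ_pair] at h
    norm_num at h
    linarith
  set V : ℝ → ℝ := fun r => min 1 (max 0 (4 - 2 * r)) * lennardJones r with hV
  -- constants
  set K : ℝ := (2 * (101 / 25) / (1 / 4) + 1) ^ Module.finrank ℝ (EuclideanSpace ℝ (Fin 3))
    with hK
  have hK0 : 0 ≤ K := by positivity
  have hK1 : 0 < K + 1 := by linarith
  have hκ' : 0 < min κ (1 / (24 * (K + 1))) := lt_min hκ (by positivity)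
  refine ⟨min κ (1 / (24 * (K + 1))), hκ', fun N y hy => ?_⟩
  set κ' : ℝ := min κ (1 / (24 * (K + 1))) with hκ'def
  have hκ'le1 : κ' ≤ κ := min_le_left _ _
  have hκ'le2 : κ' * (K + 1) ≤ 1 / 24 :=
    calc κ' * (K + 1) ≤ 1 / (24 * (K + 1)) * (K + 1) :=
          mul_le_mul_of_nonneg_right (min_le_right _ _) hK1.le
      _ = 1 / 24 := by field_simp
  -- (a) the crowd-free sites are the range of `f`
  obtain ⟨M, f, hf⟩ :=
    exists_enum fun k : Fin N => ∀ k' : Fin N, k' ≠ k → 1 / 4 ≤ dist (y k') (y k)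
  have hcf : ∀ a : Fin M, ∀ k' : Fin N, k' ≠ f a → 1 / 4 ≤ dist (y k') (y (f a)) :=
    fun a => (hf (f a)).1 ⟨a, rfl⟩
  -- (c) the non-isolated crowd-free sites are the range of `g`; `z` is their configuration
  obtain ⟨L, g, hg⟩ :=
    exists_enum fun a : Fin M => ¬ ∀ b : Fin M, b ≠ a → 2 < dist (y (f a)) (y (f b))
  set e : Fin L ↪ Fin N := g.trans f with he
  set z : Fin L → EuclideanSpace ℝ (Fin 3) := y ∘ e with hz
  have hze : Function.Injective z := hy.comp e.injective
  have hzsep : ∀ j k : Fin L, j ≠ k → 1 / 4 ≤ dist (z j) (z k) := fun j k hjk =>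
    hcf (g k) (f (g j)) fun h => hjk (g.injective (f.injective h))
  have hzdense : ∀ j : Fin L, ∃ k : Fin L, k ≠ j ∧ dist (z j) (z k) ≤ 2 := by
    intro c
    have h1 : ¬ ∀ b : Fin M, b ≠ g c → 2 < dist (y (f (g c))) (y (f b)) :=
      (hg (g c)).1 ⟨c, rfl⟩
    push Not at h1
    obtain ⟨b, hb, hd⟩ := h1
    obtain ⟨c', hc'⟩ := (hg b).2 fun h => by
      have := h (g c) hb.symm
      rw [dist_comm] at this
      linarith
    refine ⟨c', fun h => hb ?_, ?_⟩
    · rw [← hc', h]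
    · change dist (y (f (g c))) (y (f (g c'))) ≤ 2
      rw [hc']
      exact hd
  have hEz : interactionEnergy V z ≤ interactionEnergy V y := by
    have h1 : interactionEnergy V ((y ∘ f) ∘ g) = interactionEnergy V (y ∘ f) :=
      interactionEnergy_sub_eq V truncLJ_eq_zero_of_two_le (y ∘ f) g fun a ha =>
        not_not.1 (mt (hg a).2 ha)
    have h2 : z = (y ∘ f) ∘ g := funext fun c => rfl
    rw [h2, h1]
    exact interactionEnergy_crowdFree_le y hy f hf
  -- (d) the hypothesis prices `z`
  have hgz := hgap L z hze hzsep hzdense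
  -- (f) the charged counts
  set Chy := Finset.univ.filter fun i : Fin N => ¬ IsChargeFree (1 / 100 : ℝ) y i with hChy
  set Chz := Finset.univ.filter fun c : Fin L => ¬ IsChargeFree (1 / 100 : ℝ) z c with hChz
  set Q := (Finset.univ.map e)ᶜ with hQ
  set P := Chy.filter fun j => ∃ c : Fin L, e c = j ∧ IsChargeFree (1 / 100 : ℝ) z c with hP
  have hcardy : (Nat.card {i : Fin N // ¬ IsChargeFree (1 / 100 : ℝ) y i} : ℝ) = Chy.card := by
    rw [Nat.card_eq_fintype_card, Fintype.card_subtype]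
  have hcardz : (Nat.card {i : Fin L // ¬ IsChargeFree (1 / 100 : ℝ) z i} : ℝ) = Chz.card := by
    rw [Nat.card_eq_fintype_card, Fintype.card_subtype]
  have hNL : (N : ℝ) = L + Q.card := by
    have h := Finset.card_add_card_compl (Finset.univ.map e)
    rw [Finset.card_map, Finset.card_univ, Fintype.card_fin, Fintype.card_fin] at h
    exact_mod_cast h.symm
  have hcover : Chy ⊆ Q ∪ P ∪ Chz.map e := by
    intro j hj
    by_cases hjm : j ∈ Finset.univ.map e
    · obtain ⟨c, -, rfl⟩ := Finset.mem_map.1 hjm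
      by_cases hc : IsChargeFree (1 / 100 : ℝ) z c
      · exact Finset.mem_union_left _
          (Finset.mem_union_right _ (Finset.mem_filter.2 ⟨hj, c, rfl, hc⟩))
      · exact Finset.mem_union_right _
          (Finset.mem_map_of_mem e (Finset.mem_filter.2 ⟨Finset.mem_univ _, hc⟩))
    · exact Finset.mem_union_left _ (Finset.mem_union_left _ (Finset.mem_compl.2 hjm))
  have hcardCh : (Chy.card : ℝ) ≤ Q.card + P.card + Chz.card := by
    have h1 := Finset.card_le_card hcover
    have h2 := Finset.card_union_le (Q ∪ P) (Chz.map e)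
    have h3 := Finset.card_union_le Q P
    rw [Finset.card_map] at h2
    exact_mod_cast h1.trans (h2.trans (Nat.add_le_add_right h3 _))
  -- locality: a site of `P` has a dropped site within `2 (1 + 1/100) · 2 = 101/25`
  have hPw : ∀ j ∈ P, (∀ k : Fin N, k ≠ j → 1 / 4 ≤ dist (y k) (y j)) ∧
      ∃ k ∈ Q, dist (y j) (y k) ≤ 101 / 25 := by
    intro j hj
    obtain ⟨hjCh, c, rfl, hcz⟩ := Finset.mem_filter.1 hj
    refine ⟨hcf (g c), ?_⟩
    have hprem : ¬ ∀ k : Fin N,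
        dist (y k) (y (e c)) ≤ 2 * (1 + 1 / 100) * nearestDist y (e c) → k ∈ Set.range e :=
      fun h =>
        (Finset.mem_filter.1 hjCh).2 ((hloc (1 / 100) (by norm_num) N L y e c h).2 hcz)
    push Not at hprem
    obtain ⟨k, hk, hke⟩ := hprem
    obtain ⟨c', hc', hd⟩ := hzdense c
    have hnn : nearestDist y (e c) ≤ 2 :=
      (nearestDist_le_dist y fun h : e c' = e c => hc' (e.injective h)).trans hd
    refine ⟨k, Finset.mem_compl.2 fun h => hke ((mem_map_univ_iff e k).1 h), ?_⟩
    rw [dist_comm]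
    linarith
  have hPle : (P.card : ℝ) ≤ K * Q.card :=
    card_le_mul_card hy (by norm_num : (0 : ℝ) < 1 / 4) (by norm_num : (0 : ℝ) ≤ 101 / 25)
      P Q hPw
  -- (g) assemble
  rw [hcardy]
  rw [hcardz] at hgz
  have hq0 : (0 : ℝ) ≤ Q.card := Nat.cast_nonneg _
  have hChz0 : (0 : ℝ) ≤ Chz.card := Nat.cast_nonneg _
  have h1 := mul_le_mul_of_nonneg_left heStar hq0
  have h2 : κ' * P.card ≤ κ' * (K * Q.card) := mul_le_mul_of_nonneg_left hPle hκ'.le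
  have h3 : κ' * (K + 1) * Q.card ≤ 1 / 24 * Q.card := mul_le_mul_of_nonneg_right hκ'le2 hq0
  have h4 : κ' * Chz.card ≤ κ * Chz.card := mul_le_mul_of_nonneg_right hκ'le1 hChz0
  have h5 : κ' * Chy.card ≤ κ' * (Q.card + P.card + Chz.card) :=
    mul_le_mul_of_nonneg_left hcardCh hκ'.le
  rw [hNL]
  linarith

end Summit.AtomisticToContinuum.Crystallization.Theorems.PricedLinkCensusTruncatedCensusGap
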